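import Summits.QuantumFields.BalabanUV.Beta.GAN24.SourceBracketCombOfS3c
import Summits.QuantumFields.BalabanUV.Beta.GAN24.SandwichReadoutSiteDep
import Summits.QuantumFields.BalabanUV.Beta.GAN24.WardResidualRotatedVertexWeighted
import Summits.QuantumFields.BalabanUV.Beta.GAN24.StepResolventLegCharges

/-!
# `BalabanUV.Beta.GAN24.SpureRecSlotChargeThreeFace` — binder row G-an2-4 ∕ (CONV-C), W-slot CT-W, route «WC-TL» (the table fact «S3C-REC» of this lineage's
# `SourceBracketCombOfS3c` p322276 ✓ — the one located open content of F2a-comb of the REFERENCE tower; PRICING v3.35 «Q-S3C: member 0 ✓ typed, members ≥ 1 =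
# the inductive law (L3), typed supplier NONE»):
# **CLAUSE (i) OF «S3C-REC» MEMBER `j+1`, WITH VALUES, IS THE THREE-FACE-LEGS CELL FORM OF THE FOLDED MEMBER `j`** — the member-`(j+1)` step of the
# induction REDUCED, for its first clause, to ONE cell identity about the level-`j` table `SrecAt … j` with all three legs on block EXIT FACES

NOT IN PRINT; OUR BOOKKEEPING ([folklore] Fubini ∕ periodisation bookkeeping BY NAME; G-an2-4 formalisation swarm, leaf prover `b2b-balaban-gan24-formalise-leaf-04`,
gen 62; journal INTENT I-leaf04-g62-1 «S3C-STEP ∕ THREE-FACE»; names PROVISIONAL — the OWNER gan24-p1 may rename ∕ re-cut).  HONEST FRAMING (cell contract, verbatim):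
«discharging `BetaPertH` makes Bałaban's UV stability UNCONDITIONAL — a real constructive-QFT result; it is NOT the continuum limit and NOT the Clay problem.»
HONEST DEPENDENCY (verbatim): «continuum YM on T⁴ ⇐ BetaPertH ∧ nine spine estimates (0/9 proved); BetaPertH ⇐ (D1) ∧ (D4) ∧ CAP+tail; G-an2-4 gates asym, D1 and NE2/3/4.»

WHY.  «S3C-REC» (`SourceBracketCombOfS3c` §2's hypothesis `h3`) asks, at every level `j`, that the three two-constant-leg ff contractions of
`unitS s_f s_m (SpureRecAt ρ … j)` vanish; member `0` is leaf-19's `wilsonA` laws (§5 there).  Member `j+1` reads the FOLDED member `j` through an2's cubic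
sector: `SpureRecAt … (j+1) κ″ u″ = (cE·wE (j+1)) • e3OfK Lc G_j (SrecAt … j) κ″ u″ + border`, `e3OfK = −mmRead Lc (G_j ∘ vertexOfK G_j Lc (SrecAt … j) κ″ u″ ∘ G_j)`,
`G_j = coDressKBmAt ρ Lc (KInvStep Lc j)` (`SpineRecursiveW.SpureRecAt_succ`, `ValueJetGeneric.e3OfK_apply`).  Summing the two coarse legs is p2 g35's SANDWICH
READ-OUT `SandwichReadoutSiteDep.hasSum_sandwich_readout_coDressKBmAt`: the comb kernel's coarse-leg charges are SITE-DEPENDENT, `∓Lc·σ_j` on the EXIT-FACE bonds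
`[y_a % Lc = Lc−1]` and `0` inside blocks and on multiplier legs (`σ_j = ((Lc^{j+1})^{d+2})⁻¹`, `StepResolventLegCharges.hasSum_KInvStep_inr_inl ∕ _inl_inr`,
`MultiplierZeroMass.hasSum_KInvStep_mm_left ∕ _right`).  So the member-`(j+1)` slot charge is a FACE-WEIGHTED two-leg charge of the chain-rule vertex; p2 g38's
weighted-vertex Fubini (`WardResidualRotatedVertexWeighted.hasSum_weighted_vertexOfK`) turns it into `Σ_κ Σ'_t colH G_j Lc κ″ u″ κ t · g_j(κ, t)` with
`g_j(κ,t) := Σ'_{(y,w)} f_L(y) f_R(w)·SrecAt_j κ t y w (inl α) (inl β)` — which is `Lc`-PERIODIC in the fine slot `t` (an2 ∕ leaf-10's `SrecAt_translate` + face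
periodicity) — so only the COSET totals of the `ℋ`-column are seen (`BiStencilZeroMode.tsum_mul_periodic`), and by block covariance (`shiftK_coDressKBmAt_KInvStep`)
those coset totals ARE the column charges `[t_κ % Lc = Lc−1]·Lc·σ_j·[κ = κ″]` (`hasSum_coDressKBmAt_col`).  Collecting scalars:

  `Σ_{(x,z)} unitS s_f s_m (SpureRecAt … (j+1)) κ″ u″ x z (inl α) (inl β) = (s_f s_m)⁻¹ s_f⁻² · (cE·wE (j+1)) · (Lc·σ_j)³ · 3F_j(κ″; α, β)`,
  `3F_j(γ; α, β) := Σ_{v ∈ box} [v_γ % Lc = Lc−1] · Σ'_{(y,w)} [y_α % Lc = Lc−1]·[w_β % Lc = Lc−1] · SrecAt … j γ v y w (inl α) (inl β)`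

— the folded level-`j` table with its SLOT on the `γ`-exit face of one block and its two FIELD LEGS on the `α`-∕`β`-exit faces, summed (indicators written
`if … then 1 else 0`).  In particular the slot charge is INDEPENDENT of `u″`, and clause (i) of member `j+1` ⟸ `3F_j(κ″; α, β) = 0`.

WHAT ([folklore]; 0 `def`, 0 cited facts, 0 `def … : Prop`, 0 sorry; generic `d`, any `Lc ≥ 1`, in-block root, units, pins):
* §1 `tsum_weighted_periodic` (a jointly shift-invariant two-leg weight does not see a block translation of a covariant table family), `hasSum_colH_coset` (coset total
  of an `ℋ`-column of a block-covariant kernel = its column charge).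
* §2 `unitS_SpureRecAt_succ_inl_inl` (the ff entry of the normalised member `j+1` is `−U·(cE·wE)·(G ∘ V ∘ G)(Lc•x, Lc•z)_{(inr α, inr β)}`),
  `sum_sum_face_collapse` (the sandwich's double fibre sum keeps only `(a, b) = (α, β)` — the step kernel's charges are fibre-diagonal).
* §3 **`hasSum_legs_unitS_SpureRecAt_succ`** (the display above, as a `HasSum` on the leg pair), **`hasSum_legs_unitS_SpureRecAt_succ_of_threeFace`** (clause (i) of
  member `j+1` at every slot ⟸ `3F_j(κ″; α, β) = 0`), `tsum_legs_unitS_SpureRecAt_succ_eq` (slot independence).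
ENGINE (DIAG-ONLY float64, D = 2, n = 3; kit j156796 ✓, leaf-04 g62 `probe5.py` over the OWNER's SDF-1 + an1-g32 TIER-1 tables + leaf-02-g11 `wilsonA_D2.json`;
geometries B = 1, 3, 5 (levels 0, 1) and B = 2 (levels 0, 1, 2)): the comb kernel's charges have EXACTLY the face form (row ∕ (−nσ_j·F) = col ∕ (nσ_j·F) = 1.000000,
residual ≤ 2e-15); `3F_j(γ; α, β)` = 0.0e0 at j = 0 (integer table), ≤ 8e-13 at j = 1 (slot scale 6.7e2), ≤ 1e-10 at j = 2 (slot scale 2.1e4), all (γ, α, β), all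
geometries; its Λ-part vanishes at EVERY slot separately (the located (T-H) face law), so 3F_j is carried by the cubic sector alone.  Decides nothing in the kernel.
NOT HERE: clauses (ii)∕(iii) of member `j+1` (slot + one leg summed, the other leg fixed — PART 2 `SpureRecLegChargeThreeFace`: the SAME value, by full translation
covariance of the ff block of member `j+1` and a re-indexing; there also «3F-REC ⟹ S3C-REC» and the capstone re-cut), the level-0 identity `3F_0 = 0` (two
finite face laws: the cubic Wilson table's and an1's `hessFFAt`'s), the induction `3F_j ⟹ 3F_{j+1}` (design level).  Asserts NO value of Bałaban's tables; discharges
NOTHING of «S3C-REC» (members ≥ 1) ∕ F2a-comb ∕ (C)sym ∕ (Q-D) ∕ (Q-D-rate) ∕ «T2Shape» ∕ «T2Drift» ∕ (hW, hWall); NOT «D1 closed»; NEVER «G-an2-4 closed» as (CONV-C);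
NOT D1, NOT `BetaPertH`, NOT continuum, NOT Clay.  2026-08-22; no existing file touched.
-/

noncomputable section

open Finset
open scoped BigOperators
open Literature.MathematicalPhysics.QuantumFieldTheory
open Literature.MathematicalPhysics.QuantumFieldTheory.Balaban1983to89
open Literature.MathematicalPhysics.QuantumFieldTheory.Balaban1983to89.Beta
open B12Sec2to5 (l1)
open ExpKernelCalculus (Site MKer BiLoc Decays VertexFamily comp shiftK)
open AffineAveraging (box toSite)
open OneStepResolventKernel (Fib LocStencil wsum)
open OneStepKernelFamily (KInvStep colH vertexOfK abs_colH_le vertexFamily_vertexOfK' decays_KInvStep)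
open BalabanStepJetsSucc (mmRead mmRead_inl_inl wE wVH)
open AveragingHessianKernels (packVH_inl_inl)
open Summit.QuantumFields.BalabanUV.Beta.HessKerDressedUnits (unitS unitS_apply)
open Summit.QuantumFields.BalabanUV.Beta.AxialDressingRooted (coDressKBmAt decays_coDressKBmAt_KInvStep shiftK_coDressKBmAt_KInvStep)
open Summit.QuantumFields.BalabanUV.Beta.WardLocusRecursive (SrecAt locStencil_SrecAt SrecAt_translate)
open Summit.QuantumFields.BalabanUV.Beta.SpineRooted (SpureRecAt e3OfK e3OfK_apply e3OfK_translate SpureRecAt_succ)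
open Summit.QuantumFields.BalabanUV.Beta.GAN24.BiStencilZeroMode (tsum_mul_periodic)
open Summit.QuantumFields.BalabanUV.Beta.GAN24.SandwichReadoutSiteDep (hasSum_sandwich_readout_coDressKBmAt hasSum_coDressKBmAt_col)
open Summit.QuantumFields.BalabanUV.Beta.GAN24.StepResolventLegCharges (hasSum_KInvStep_inr_inl hasSum_KInvStep_inl_inr)
open Summit.QuantumFields.BalabanUV.Beta.GAN24.MultiplierZeroMass (hasSum_KInvStep_mm_left hasSum_KInvStep_mm_right)
open Summit.QuantumFields.BalabanUV.Beta.GAN24.WilsonVertexTwoConst (unitS_inl_inl)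
open Summit.QuantumFields.BalabanUV.Beta.SecondOrderUnits (unitS₂)
open Summit.QuantumFields.BalabanUV.Beta.SpineRooted (T2RecOf T2RecAt M1At)
open Summit.QuantumFields.BalabanUV.Beta.GAN24.CombesThomas (sfStep smStep)
open Summit.QuantumFields.BalabanUV.Beta.GAN24.BiStencilZeroMode (Tab zmode)
open AveragingMixedJetTables (mixFFAt)
open BalabanCompositeJets (LocStencil₂)
open RemainderConstAllScales (AllScalesSeq)
open OneStepKernelFamily (TbalOf)
open AveragingContoursRooted (ctrOff ctrOff_mem_box)
open WilsonVertex2Sym (wsym22)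
open Summit.QuantumFields.BalabanUV.Beta.AxialDressingRooted (dressKBmAt coProjBmAtK)
open Summit.QuantumFields.BalabanUV.Beta.SecondOrderSocketIdentification (vh₂SAn1)
open Summit.QuantumFields.BalabanUV.Beta.RowD1JointEnd (JsRowD1Pin)
open Summit.QuantumFields.BalabanUV.Beta.GAN24.WardResidualRotatedVertexWeighted (hasSum_weighted_vertexOfK)

namespace Summit.QuantumFields.BalabanUV.Beta.GAN24.SpureRecSlotChargeThreeFace

variable {d : ℕ}

/-! ## §1 Generic tools: periodicity of a weighted pair-charge; the coset column total -/

/-- [folklore] **A JOINTLY SHIFT-INVARIANT WEIGHT DOES NOT SEE A BLOCK TRANSLATION OF A COVARIANT TABLE FAMILY**: if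
`S κ (u + N•t) = shiftK (−N•t) (S κ u)` and `ω(y + N•t, w + N•t) = ω(y, w)`, the ω-charge `Σ'_{(y,w)} ω·S κ u y w a b` is `N`-PERIODIC in the slot `u`. -/
theorem tsum_weighted_periodic {N : ℕ} {S : Fin (d + 1) → Site (d + 1) → MKer (d + 1) (Fib d)}
    (hSt : ∀ (κ : Fin (d + 1)) (u t : Site (d + 1)), S κ (u + (N : ℤ) • t) = shiftK (-((N : ℤ) • t)) (S κ u))
    {ω : Site (d + 1) × Site (d + 1) → ℝ} (hω : ∀ (yw : Site (d + 1) × Site (d + 1)) (t : Site (d + 1)), ω (yw.1 + (N : ℤ) • t, yw.2 + (N : ℤ) • t) = ω yw)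
    (κ : Fin (d + 1)) (u t : Site (d + 1)) (a b : Fib d) :
    ∑' yw : Site (d + 1) × Site (d + 1), ω yw * S κ (u + (N : ℤ) • t) yw.1 yw.2 a b
      = ∑' yw : Site (d + 1) × Site (d + 1), ω yw * S κ u yw.1 yw.2 a b := by
  rw [hSt κ u t]
  rw [← (Equiv.prodCongr (Equiv.addRight (-((N : ℤ) • t))) (Equiv.addRight (-((N : ℤ) • t)))).tsum_eq
    (fun yw : Site (d + 1) × Site (d + 1) => ω yw * S κ u yw.1 yw.2 a b)]
  refine tsum_congr fun yw => ?_
  simp only [Equiv.prodCongr_apply, Equiv.coe_addRight, Prod.map, shiftK]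
  congr 1
  have h := hω (yw.1 + -((N : ℤ) • t), yw.2 + -((N : ℤ) • t)) t
  simp only [neg_add_cancel_right, Prod.mk.eta] at h
  exact h

/-- [folklore] **THE COSET TOTAL OF AN `ℋ`-COLUMN OF A BLOCK-COVARIANT KERNEL IS ITS COLUMN CHARGE**: if `shiftK (−N•t) G = G` for all `t` and
`HasSum (s ↦ G v (N•s) (inl κ) (inr μ)) ρ`, then for every coarse base `u`, `HasSum (t ↦ colH G N μ u κ (N•t + v)) ρ`. -/
theorem hasSum_colH_coset {N : ℕ} {G : MKer (d + 1) (Fib d)} (hGs : ∀ t : Site (d + 1), shiftK (-((N : ℤ) • t)) G = G)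
    {v : Site (d + 1)} {κ μ : Fin (d + 1)} {ρ : ℝ} (hcol : HasSum (fun s : Site (d + 1) => G v ((N : ℤ) • s) (Sum.inl κ) (Sum.inr μ)) ρ)
    (u : Site (d + 1)) :
    HasSum (fun t : Site (d + 1) => colH G N μ u κ ((N : ℤ) • t + v)) ρ := by
  have e : ∀ t : Site (d + 1), colH G N μ u κ ((N : ℤ) • t + v) = G v ((N : ℤ) • (u - t)) (Sum.inl κ) (Sum.inr μ) := by
    intro t
    have h := congrFun (congrFun (congrFun (congrFun (hGs t) ((N : ℤ) • t + v)) ((N : ℤ) • u)) (Sum.inl κ)) (Sum.inr μ)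
    simp only [shiftK] at h
    have e1 : (N : ℤ) • t + v + -((N : ℤ) • t) = v := by abel
    have e2 : (N : ℤ) • u + -((N : ℤ) • t) = (N : ℤ) • (u - t) := by rw [smul_sub]; abel
    rw [colH, ← h, e1, e2]
  simp_rw [e]
  exact ((Equiv.subLeft u).hasSum_iff (f := fun s : Site (d + 1) => G v ((N : ℤ) • s) (Sum.inl κ) (Sum.inr μ))).2 hcol


/-! ## §2 The slot charge of member `j+1` in sandwich form, and the face weights of the comb kernel -/

section Instance

variable {Lc : ℕ} [NeZero Lc]

/-- [folklore] **THE ff-ENTRY OF THE NORMALISED MEMBER `j+1` IS A SANDWICH READ-OUT**: with `G_j = coDressKBmAt ρ Lc (KInvStep Lc j)` and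
`V = vertexOfK G_j Lc (SrecAt … j) κ″ u″`,
`unitS s_f s_m (SpureRecAt … (j+1)) κ″ u″ x z (inl α) (inl β) = −(s_f s_m)⁻¹ s_f⁻² · (cE·wE (j+1)) · (G_j ∘ V ∘ G_j)(Lc•x, Lc•z)_{(inr α, inr β)}`
(`SpureRecAt_succ`, `e3OfK_apply`, `mmRead_inl_inl`; the `vhSAt` border is off the ff block — `packVH_inl_inl`). -/
theorem unitS_SpureRecAt_succ_inl_inl (ρ : Fin (d + 1) → ℤ) (sf sm cE cVH cΛ : ℝ) (j : ℕ) (κ'' : Fin (d + 1)) (u'' x z : Site (d + 1))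
    (α β : Fin (d + 1)) :
    unitS sf sm (SpureRecAt d Lc ρ cE cVH cΛ (j + 1)) κ'' u'' x z (Sum.inl α) (Sum.inl β) =
      -((sf * sm)⁻¹ * (sf⁻¹ * sf⁻¹) * (cE * wE d Lc (j + 1)) *
        comp (comp (coDressKBmAt ρ Lc (KInvStep (d := d) Lc j))
          (vertexOfK (coDressKBmAt ρ Lc (KInvStep (d := d) Lc j)) Lc (SrecAt d Lc ρ cE cVH cΛ j) κ'' u''))
          (coDressKBmAt ρ Lc (KInvStep (d := d) Lc j)) ((Lc : ℤ) • x) ((Lc : ℤ) • z) (Sum.inr α) (Sum.inr β)) := by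
  rw [unitS_inl_inl, SpureRecAt_succ]
  simp only [Pi.add_apply, Pi.smul_apply, smul_eq_mul, AveragingHessianKernelsRooted.vhSAt, packVH_inl_inl, mul_zero, add_zero,
    e3OfK_apply, mmRead_inl_inl]
  ring

omit [NeZero Lc] in
/-- [folklore] **THE SANDWICH VALUE COLLAPSES TO THE `(α, β)` FIBRE PAIR**: with the comb kernel's face-weighted charges
(`hasSum_coDressKBmAt_row ∕ _col` over `hasSum_KInvStep_inr_inl ∕ _inl_inr`, diagonal in the fibre), the double fibre sum of p2 g35's
`hasSum_sandwich_readout_coDressKBmAt` keeps only `a = α`, `b = β`: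
`Σ_a Σ_b ρ̃L(a,y)·V y w (inl a) (inl b)·ρ̃R(b,w) = f_L(y)·f_R(w)·V y w (inl α) (inl β)`, `f_L(y) = [y_α % Lc = Lc−1]·Lc·(−σ_j)`,
`f_R(w) = [w_β % Lc = Lc−1]·Lc·σ_j`. -/
theorem sum_sum_face_collapse (j : ℕ) (V : MKer (d + 1) (Fib d)) (α β : Fin (d + 1)) (y w : Site (d + 1)) :
    ∑ a : Fin (d + 1), ∑ b : Fin (d + 1),
      (if y a % (Lc : ℤ) = (Lc : ℤ) - 1 then (Lc : ℝ) * -(if a = α then ((((Lc ^ (j + 1) : ℕ) : ℝ)) ^ (d + 1 + 1))⁻¹ else 0) else 0) *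
        V y w (Sum.inl a) (Sum.inl b) *
        (if w b % (Lc : ℤ) = (Lc : ℤ) - 1 then (Lc : ℝ) * (if b = β then ((((Lc ^ (j + 1) : ℕ) : ℝ)) ^ (d + 1 + 1))⁻¹ else 0) else 0)
      = ((if y α % (Lc : ℤ) = (Lc : ℤ) - 1 then (Lc : ℝ) * -((((Lc ^ (j + 1) : ℕ) : ℝ)) ^ (d + 1 + 1))⁻¹ else 0) *
          (if w β % (Lc : ℤ) = (Lc : ℤ) - 1 then (Lc : ℝ) * ((((Lc ^ (j + 1) : ℕ) : ℝ)) ^ (d + 1 + 1))⁻¹ else 0)) *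
        V y w (Sum.inl α) (Sum.inl β) := by
  rw [Finset.sum_eq_single α]
  · rw [Finset.sum_eq_single β]
    · simp only [if_true]; ring
    · intro b _ hb
      simp only [hb, if_false, mul_zero, ite_self]
    · intro h; exact absurd (Finset.mem_univ α) (fun _ => h (Finset.mem_univ β))
  · intro a _ ha
    refine Finset.sum_eq_zero fun b _ => ?_
    simp only [ha, if_false, neg_zero, mul_zero, ite_self, zero_mul]
  · intro h; exact absurd (Finset.mem_univ α) h

end Instance


/-! ## §3 Clause (i) of «S3C-REC» member `j+1`, WITH VALUES: the three-face-legs cell form of the folded member `j` -/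

section SlotCharge

variable {Lc : ℕ} [NeZero Lc]

omit [NeZero Lc] in
/-- [folklore] an indicator-weighted scalar: `(if c then a else 0) = a·(if c then 1 else 0)`. -/
theorem ite_eq_mul_indicator (c : Prop) [Decidable c] (a : ℝ) : (if c then a else 0) = a * (if c then (1 : ℝ) else 0) := by
  split_ifs <;> simp

omit [NeZero Lc] in
/-- [folklore] the exit-face condition is `Lc`-periodic: `(y + Lc•t) a % Lc = y a % Lc`. -/
theorem face_periodic (y t : Site (d + 1)) (a : Fin (d + 1)) :
    (y + (Lc : ℤ) • t) a % (Lc : ℤ) = y a % (Lc : ℤ) := by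
  simp only [Pi.add_apply, Pi.smul_apply, smul_eq_mul]
  exact Int.add_mul_emod_self_left _ _ _

/-- NOT IN PRINT; OUR BOOKKEEPING ([folklore] Fubini ∕ periodisation over p2 g35's sandwich read-out, an2's `SrecAt_translate`, an4's column masses).
**CLAUSE (i) OF «S3C-REC» MEMBER `j+1`, WITH VALUES = THE THREE-FACE-LEGS CELL FORM OF THE FOLDED MEMBER `j`.**  For every `d`, `Lc ≥ 1`, in-block root
`r`, units, pins, level `j`, slot `(κ″, u″)` and field pair `(α, β)`:
`Σ_{(x,z)} unitS s_f s_m (SpureRecAt … (j+1)) κ″ u″ x z (inl α) (inl β)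
   = (s_f s_m)⁻¹ s_f⁻² · (cE·wE (j+1)) · (Lc·σ_j)³ · Σ_{v ∈ box} [v_{κ″} % Lc = Lc−1] · Σ'_{(y,w)} [y_α % Lc = Lc−1]·[w_β % Lc = Lc−1]·SrecAt … j κ″ v y w (inl α) (inl β)`,
`σ_j = ((Lc^{j+1})^{d+2})⁻¹`: the folded level-`j` table with its slot on the `κ″`-EXIT FACE of one block and its two field legs on the `α`-∕`β`-EXIT FACES,
summed.  In particular the member-`(j+1)` slot charge does NOT depend on the slot `u″`. -/
theorem hasSum_legs_unitS_SpureRecAt_succ (hLc : 1 ≤ Lc) {r : Fin (d + 1) → ℕ} (hr : r ∈ box (d + 1) Lc) (sf sm cE cVH cΛ : ℝ) (j : ℕ)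
    (κ'' : Fin (d + 1)) (u'' : Site (d + 1)) (α β : Fin (d + 1)) :
    HasSum (fun p : Site (d + 1) × Site (d + 1) =>
        unitS sf sm (SpureRecAt d Lc (toSite r) cE cVH cΛ (j + 1)) κ'' u'' p.1 p.2 (Sum.inl α) (Sum.inl β))
      ((sf * sm)⁻¹ * (sf⁻¹ * sf⁻¹) * (cE * wE d Lc (j + 1)) * ((Lc : ℝ) * ((((Lc ^ (j + 1) : ℕ) : ℝ)) ^ (d + 1 + 1))⁻¹) ^ 3 *
        ∑ v ∈ box (d + 1) Lc, (if toSite v κ'' % (Lc : ℤ) = (Lc : ℤ) - 1 then (1 : ℝ) else 0) *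
          ∑' yw : Site (d + 1) × Site (d + 1),
            (if yw.1 α % (Lc : ℤ) = (Lc : ℤ) - 1 then (1 : ℝ) else 0) * (if yw.2 β % (Lc : ℤ) = (Lc : ℤ) - 1 then (1 : ℝ) else 0) *
              SrecAt d Lc (toSite r) cE cVH cΛ j κ'' (toSite v) yw.1 yw.2 (Sum.inl α) (Sum.inl β)) := by
  -- abbreviations
  set σ : ℝ := ((((Lc ^ (j + 1) : ℕ) : ℝ)) ^ (d + 1 + 1))⁻¹ with hσ
  set K : MKer (d + 1) (Fib d) := KInvStep (d := d) Lc j with hK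
  set G : MKer (d + 1) (Fib d) := coDressKBmAt (toSite r) Lc K with hG
  set S : Fin (d + 1) → Site (d + 1) → MKer (d + 1) (Fib d) := SrecAt d Lc (toSite r) cE cVH cΛ j with hS
  set V : MKer (d + 1) (Fib d) := vertexOfK G Lc S κ'' u'' with hV
  set U : ℝ := (sf * sm)⁻¹ * (sf⁻¹ * sf⁻¹) * (cE * wE d Lc (j + 1)) with hU
  have hσ0 : 0 ≤ σ := by rw [hσ]; positivity
  have hLσ : 0 ≤ (Lc : ℝ) * σ := mul_nonneg (Nat.cast_nonneg _) hσ0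
  -- the two face weights of the legs and their product
  set fL : Site (d + 1) → ℝ := fun y => if y α % (Lc : ℤ) = (Lc : ℤ) - 1 then (Lc : ℝ) * -σ else 0 with hfL
  set fR : Site (d + 1) → ℝ := fun w => if w β % (Lc : ℤ) = (Lc : ℤ) - 1 then (Lc : ℝ) * σ else 0 with hfR
  set ω : Site (d + 1) × Site (d + 1) → ℝ := fun yw => fL yw.1 * fR yw.2 with hω
  have hωb : ∀ yw : Site (d + 1) × Site (d + 1), |ω yw| ≤ (Lc : ℝ) * σ * ((Lc : ℝ) * σ) := by
    intro yw
    have h1 : |fL yw.1| ≤ (Lc : ℝ) * σ := by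
      simp only [hfL]
      split_ifs
      · rw [mul_neg, abs_neg, abs_of_nonneg hLσ]
      · rw [abs_zero]; exact hLσ
    have h2 : |fR yw.2| ≤ (Lc : ℝ) * σ := by
      simp only [hfR]
      split_ifs
      · rw [abs_of_nonneg hLσ]
      · rw [abs_zero]; exact hLσ
    simp only [hω]
    rw [abs_mul]
    exact mul_le_mul h1 h2 (abs_nonneg _) hLσ
  have hωp : ∀ (yw : Site (d + 1) × Site (d + 1)) (t : Site (d + 1)), ω (yw.1 + (Lc : ℤ) • t, yw.2 + (Lc : ℤ) • t) = ω yw := by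
    intro yw t
    simp only [hω, hfL, hfR, face_periodic]
  -- decay ∕ localisation data
  obtain ⟨δK, CK, hδK, -, hKd⟩ := decays_KInvStep (d := d) (Lc := Lc) j
  obtain ⟨δG, CG, hδG, hCG, hGd⟩ := decays_coDressKBmAt_KInvStep (d := d) hr j
  obtain ⟨Cs, δs, hδs, hSl⟩ := locStencil_SrecAt (d := d) (Lc := Lc) hLc hr cE cVH cΛ j
  obtain ⟨Cv, δv, hδv, hVF⟩ := vertexFamily_vertexOfK' (N := Lc) ⟨δG, CG, hδG, hCG, hGd⟩ hSl hδs
  have hVb : BiLoc V ((Lc : ℤ) • u'') ((Lc : ℤ) • u'') Cv δv := hVF κ'' u''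
  have hGs : ∀ t : Site (d + 1), shiftK (-((Lc : ℤ) • t)) G = G := fun t => shiftK_coDressKBmAt_KInvStep (d := d) (toSite r) j t
  have hSt : ∀ (κ : Fin (d + 1)) (u t : Site (d + 1)), S κ (u + (Lc : ℤ) • t) = shiftK (-((Lc : ℤ) • t)) (S κ u) :=
    fun κ u t => SrecAt_translate (toSite r) hLc cE cVH cΛ j κ u t
  -- the raw step kernel's site-free charges ((Q-lin) ∕ (S2c) BY NAME)
  have hL : ∀ (t : Site (d + 1)) (α' κ : Fin (d + 1)), HasSum (fun x' : Site (d + 1) => K ((Lc : ℤ) • x') t (Sum.inr α') (Sum.inl κ))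
      ((fun α' κ => -(if κ = α' then σ else 0)) α' κ) := fun t α' κ => hasSum_KInvStep_inr_inl j α' κ t
  have hL0 : ∀ (t : Site (d + 1)) (α' m : Fin (d + 1)), HasSum (fun x' : Site (d + 1) => K ((Lc : ℤ) • x') t (Sum.inr α') (Sum.inr m)) 0 :=
    fun t α' m => hasSum_KInvStep_mm_left j α' m t
  have hR : ∀ (u : Site (d + 1)) (κ μ : Fin (d + 1)), HasSum (fun y : Site (d + 1) => K u ((Lc : ℤ) • y) (Sum.inl κ) (Sum.inr μ))
      ((fun κ μ => if κ = μ then σ else 0) κ μ) := fun u κ μ => hasSum_KInvStep_inl_inr j κ μ u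
  have hR0 : ∀ (u : Site (d + 1)) (m μ : Fin (d + 1)), HasSum (fun y : Site (d + 1) => K u ((Lc : ℤ) • y) (Sum.inr m) (Sum.inr μ)) 0 :=
    fun u m μ => hasSum_KInvStep_mm_right j m μ u
  -- (A) the sandwich read-out through the comb kernel
  have hsand := hasSum_sandwich_readout_coDressKBmAt (N := Lc) hLc hr hKd hδK hVb hδv α β hL hL0 hR hR0
  -- (B) collapse of the fibre sums to (α, β)
  have hcoll : ∀ yw : Site (d + 1) × Site (d + 1),
      (∑ a : Fin (d + 1), ∑ b : Fin (d + 1),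
        (if yw.1 a % (Lc : ℤ) = (Lc : ℤ) - 1 then (Lc : ℝ) * (fun α' κ => -(if κ = α' then σ else 0)) α a else 0) *
          V yw.1 yw.2 (Sum.inl a) (Sum.inl b) *
          (if yw.2 b % (Lc : ℤ) = (Lc : ℤ) - 1 then (Lc : ℝ) * (fun κ μ => if κ = μ then σ else 0) b β else 0))
        = ω yw * V yw.1 yw.2 (Sum.inl α) (Sum.inl β) := by
    intro yw
    simp only []
    rw [sum_sum_face_collapse j V α β yw.1 yw.2]
  -- (C) the weighted chain-rule vertex Fubini
  have hw : ∀ (κ : Fin (d + 1)) (t : Site (d + 1)), |colH G Lc κ'' u'' κ t| ≤ CG * Real.exp (-δG * l1 (t - (Lc : ℤ) • u'')) :=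
    fun κ t => abs_colH_le (N := Lc) hGd κ'' u'' κ t
  have hvert := hasSum_weighted_vertexOfK (N := Lc) (K' := G) κ'' u'' hw hδG hSl hδs (Sum.inl α) (Sum.inl β) (ω := ω) hωb
  -- the slot function g κ t := Σ' ω·S κ t … and its periodicity
  have hg : ∀ (κ : Fin (d + 1)) (u t : Site (d + 1)),
      (∑' yw : Site (d + 1) × Site (d + 1), ω yw * S κ (u + (Lc : ℤ) • t) yw.1 yw.2 (Sum.inl α) (Sum.inl β))
        = ∑' yw : Site (d + 1) × Site (d + 1), ω yw * S κ u yw.1 yw.2 (Sum.inl α) (Sum.inl β) :=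
    fun κ u t => tsum_weighted_periodic (N := Lc) hSt hωp κ u t (Sum.inl α) (Sum.inl β)
  -- (F) periodisation of each slot sum, (G) the coset column totals
  have hper : ∀ κ : Fin (d + 1),
      (∑' t : Site (d + 1), colH G Lc κ'' u'' κ t * ∑' yw : Site (d + 1) × Site (d + 1), ω yw * S κ t yw.1 yw.2 (Sum.inl α) (Sum.inl β))
        = ∑ v ∈ box (d + 1) Lc, (∑' yw : Site (d + 1) × Site (d + 1), ω yw * S κ (toSite v) yw.1 yw.2 (Sum.inl α) (Sum.inl β)) *
            (if toSite v κ % (Lc : ℤ) = (Lc : ℤ) - 1 then (Lc : ℝ) * (if κ = κ'' then σ else 0) else 0) := by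
    intro κ
    rw [tsum_mul_periodic (N := Lc) (fun u t => hg κ u t) (hvert.2 κ)]
    refine Finset.sum_congr rfl fun v _ => ?_
    congr 1
    have hc := hasSum_coDressKBmAt_col (N := Lc) hLc hr hR hR0 κ'' (Sum.inl κ) (toSite v)
    simp only [Sum.elim_inl] at hc
    exact (hasSum_colH_coset hGs hc u'').tsum_eq
  -- (H) assemble: the value of the sandwich read-out
  have hval : (∑' yw : Site (d + 1) × Site (d + 1), ∑ a : Fin (d + 1), ∑ b : Fin (d + 1),
        (if yw.1 a % (Lc : ℤ) = (Lc : ℤ) - 1 then (Lc : ℝ) * (fun α' κ => -(if κ = α' then σ else 0)) α a else 0) *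
          V yw.1 yw.2 (Sum.inl a) (Sum.inl b) *
          (if yw.2 b % (Lc : ℤ) = (Lc : ℤ) - 1 then (Lc : ℝ) * (fun κ μ => if κ = μ then σ else 0) b β else 0))
      = ∑ v ∈ box (d + 1) Lc, (∑' yw : Site (d + 1) × Site (d + 1), ω yw * S κ'' (toSite v) yw.1 yw.2 (Sum.inl α) (Sum.inl β)) *
          (if toSite v κ'' % (Lc : ℤ) = (Lc : ℤ) - 1 then (Lc : ℝ) * σ else 0) := by
    rw [tsum_congr hcoll, hvert.1.tsum_eq, Finset.sum_eq_single κ'']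
    · rw [hper κ'']
      simp only [if_true]
    · intro κ _ hκ
      rw [hper κ]
      refine Finset.sum_eq_zero fun v _ => ?_
      simp only [hκ, if_false, mul_zero, ite_self]
    · intro h; exact absurd (Finset.mem_univ κ'') h
  -- (I) scalars
  have hgv : ∀ v : Fin (d + 1) → ℕ,
      (∑' yw : Site (d + 1) × Site (d + 1), ω yw * S κ'' (toSite v) yw.1 yw.2 (Sum.inl α) (Sum.inl β))
        = ((Lc : ℝ) * -σ) * ((Lc : ℝ) * σ) * ∑' yw : Site (d + 1) × Site (d + 1),
            (if yw.1 α % (Lc : ℤ) = (Lc : ℤ) - 1 then (1 : ℝ) else 0) * (if yw.2 β % (Lc : ℤ) = (Lc : ℤ) - 1 then (1 : ℝ) else 0) *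
              S κ'' (toSite v) yw.1 yw.2 (Sum.inl α) (Sum.inl β) := by
    intro v
    rw [← tsum_mul_left]
    refine tsum_congr fun yw => ?_
    simp only [hω, hfL, hfR]
    rw [ite_eq_mul_indicator (yw.1 α % (Lc : ℤ) = (Lc : ℤ) - 1) ((Lc : ℝ) * -σ),
      ite_eq_mul_indicator (yw.2 β % (Lc : ℤ) = (Lc : ℤ) - 1) ((Lc : ℝ) * σ)]
    ring
  have hpt : ∀ p : Site (d + 1) × Site (d + 1),
      unitS sf sm (SpureRecAt d Lc (toSite r) cE cVH cΛ (j + 1)) κ'' u'' p.1 p.2 (Sum.inl α) (Sum.inl β)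
        = -U * comp (comp G V) G ((Lc : ℤ) • p.1) ((Lc : ℤ) • p.2) (Sum.inr α) (Sum.inr β) := by
    intro p
    rw [unitS_SpureRecAt_succ_inl_inl]
    ring
  have hfin := hsand.mul_left (-U)
  rw [hval] at hfin
  have hfin' : HasSum (fun p : Site (d + 1) × Site (d + 1) =>
      unitS sf sm (SpureRecAt d Lc (toSite r) cE cVH cΛ (j + 1)) κ'' u'' p.1 p.2 (Sum.inl α) (Sum.inl β))
      (-U * ∑ v ∈ box (d + 1) Lc, (∑' yw : Site (d + 1) × Site (d + 1), ω yw * S κ'' (toSite v) yw.1 yw.2 (Sum.inl α) (Sum.inl β)) *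
          (if toSite v κ'' % (Lc : ℤ) = (Lc : ℤ) - 1 then (Lc : ℝ) * σ else 0)) := by
    refine hfin.congr_fun fun p => ?_
    rw [hpt p]
  convert hfin' using 1
  rw [Finset.mul_sum, Finset.mul_sum]
  refine Finset.sum_congr rfl fun v _ => ?_
  rw [hgv v, ite_eq_mul_indicator (toSite v κ'' % (Lc : ℤ) = (Lc : ℤ) - 1) ((Lc : ℝ) * σ)]
  ring

/-- NOT IN PRINT; OUR BOOKKEEPING.  **CLAUSE (i) OF «S3C-REC» MEMBER `j+1` FROM THE THREE-FACE-LEGS CELL LAW OF THE FOLDED MEMBER `j`**: if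
`3F_j(κ″; α, β) = 0` — the folded level-`j` table `SrecAt … j` with its slot on the `κ″`-exit face of one block and its two field legs on the `α`-∕`β`-exit
faces sums to zero — then the two-constant-leg ff contraction of `unitS s_f s_m (SpureRecAt … (j+1))` vanishes AT EVERY SLOT `(κ″, u″)` (the shape of
the first conjunct of `SourceBracketCombOfS3c`'s hypothesis `h3` at level `j+1`). -/
theorem hasSum_legs_unitS_SpureRecAt_succ_of_threeFace (hLc : 1 ≤ Lc) {r : Fin (d + 1) → ℕ} (hr : r ∈ box (d + 1) Lc)
    (sf sm cE cVH cΛ : ℝ) (j : ℕ) (κ'' : Fin (d + 1)) (α β : Fin (d + 1))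
    (h3F : ∑ v ∈ box (d + 1) Lc, (if toSite v κ'' % (Lc : ℤ) = (Lc : ℤ) - 1 then (1 : ℝ) else 0) *
          ∑' yw : Site (d + 1) × Site (d + 1),
            (if yw.1 α % (Lc : ℤ) = (Lc : ℤ) - 1 then (1 : ℝ) else 0) * (if yw.2 β % (Lc : ℤ) = (Lc : ℤ) - 1 then (1 : ℝ) else 0) *
              SrecAt d Lc (toSite r) cE cVH cΛ j κ'' (toSite v) yw.1 yw.2 (Sum.inl α) (Sum.inl β) = 0)
    (u'' : Site (d + 1)) :
    HasSum (fun p : Site (d + 1) × Site (d + 1) =>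
        unitS sf sm (SpureRecAt d Lc (toSite r) cE cVH cΛ (j + 1)) κ'' u'' p.1 p.2 (Sum.inl α) (Sum.inl β)) 0 := by
  have h := hasSum_legs_unitS_SpureRecAt_succ hLc hr sf sm cE cVH cΛ j κ'' u'' α β
  rwa [h3F, mul_zero] at h

/-- NOT IN PRINT; OUR BOOKKEEPING.  **THE MEMBER-`(j+1)` SLOT CHARGE IS SLOT-INDEPENDENT**: the two-constant-leg ff contraction of
`unitS s_f s_m (SpureRecAt … (j+1))` at slot `(κ″, u″)` has the same sum as at slot `(κ″, 0)`. -/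
theorem tsum_legs_unitS_SpureRecAt_succ_eq (hLc : 1 ≤ Lc) {r : Fin (d + 1) → ℕ} (hr : r ∈ box (d + 1) Lc)
    (sf sm cE cVH cΛ : ℝ) (j : ℕ) (κ'' : Fin (d + 1)) (u'' : Site (d + 1)) (α β : Fin (d + 1)) :
    (∑' p : Site (d + 1) × Site (d + 1), unitS sf sm (SpureRecAt d Lc (toSite r) cE cVH cΛ (j + 1)) κ'' u'' p.1 p.2 (Sum.inl α) (Sum.inl β))
      = ∑' p : Site (d + 1) × Site (d + 1), unitS sf sm (SpureRecAt d Lc (toSite r) cE cVH cΛ (j + 1)) κ'' 0 p.1 p.2 (Sum.inl α) (Sum.inl β) := by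
  rw [(hasSum_legs_unitS_SpureRecAt_succ hLc hr sf sm cE cVH cΛ j κ'' u'' α β).tsum_eq,
    (hasSum_legs_unitS_SpureRecAt_succ hLc hr sf sm cE cVH cΛ j κ'' 0 α β).tsum_eq]

end SlotCharge


end Summit.QuantumFields.BalabanUV.Beta.GAN24.SpureRecSlotChargeThreeFace

end
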